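/-
Copyright (c) 2026. All rights reserved.
Released under Apache 2.0 license as described in the file LICENSE.
-/
import Literature.Probability.LatticeModels.PinningLemma
import HarnessLib

/-!
# Anchoring of the pinning structure (Georgii–Higuchi 2000, Lemma 5.2, hypothesis)

Georgii–Higuchi, J. Math. Phys. 41 (2000), Lemma 5.2, starts from the hypothesis "`μ`-almost surely
there exists an infinite `+∗`cluster `I^{+∗}_up` in `π_up` which meets the right semiaxis `ℓ_right`
infinitely often" and its first proof line "the infinite component of `I^{+∗}_up ∖ Δ` almost surely
contains infinitely many points of `ℓ_right`". In the mirror-image orientation used by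
`PinningLemma` (pinning far to the *left*), and for the pinning structure `J = pinJ m` of
`PinningDomain` (sites whose `+∗`cluster in `U = S⁺ ∩ (π_up ∖ (Λ_m ∪ ℓ_{≥ -m}))` is infinite), this
file proves the corresponding statement, the event `LeftAnchoredInf m` of `PinningLemma`:

* `leftAnchoredInf_of_cluster` — (deterministic) if the `+∗`cluster `C` of the upper half-plane
  through `x₀` has axis sites unboundedly far to the left and only boundedly far to the right, then
  some axis site of `J` has a `U`-cluster with axis sites unboundedly far to the left. Proof: the
  removed part `F = C ∩ (Λ_m ∪ ℓ_{≥ -m})` is finite; every site of `C ∖ F` is joined inside `C ∖ F ⊆ U`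
  to the finite set of `∗`-neighbours of `F` or to a fixed touch (walk inside `C`, cut at the first
  visit to `F`), so the infinitely many touches left of `-m` are covered by finitely many
  `U`-clusters, one of which contains infinitely many of them;
* `ae_leftAnchoredInf` — almost surely `LeftAnchoredInf m`, for `β > β_c(2)` and `μ ∈ 𝒢(β, 0)`
  under which the infinite `+∗`cluster of `π_up` touches the axis outside every box on the left and
  an infinite `-`cluster of `π_up` exists (the orientation "`+`face on the left" of the coexistence
  case; the touches are bounded on the right by the sides lemma `ae_plusStar_minus_sides`).

## References

* H.-O. Georgii, Y. Higuchi, J. Math. Phys. 41 (2000) 1153–1169, Lemma 5.2 and its proof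
  [GeorgiiHiguchi2000].
-/

namespace Literature.Probability.LatticeModels

open MeasureTheory SimpleGraph Percolation Filter

noncomputable section

/-! ### Deterministic part -/

section Det

variable {m : ℕ} {ω : SpinConfig (Site 2)}

/-- `![a, b] = mkSite a b`. [folklore] -/
theorem vec_eq_mkSite (a b : ℤ) : (![a, b] : Site 2) = mkSite a b := by
  ext i; fin_cases i <;> rfl

/-- Sites of a half-plane `+∗`cluster off `Λ_m` and off the far half-axis are `U`-sites. [folklore] -/
theorem mem_pinU_of_mem_cluster {G : SimpleGraph (Site 2)} {x₀ z : Site 2} (hz : z ∈ siteCluster G (spinSites 1 ω ∩ halfPlane 0) x₀)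
    (hzb : z ∉ box 2 m) (hzf : z ∉ farAxis m) : z ∈ pinU m ω :=
  ⟨hz.2.1.1, hz.2.1.2, fun h => h.elim (fun h => hzb (Finset.mem_coe.1 h)) hzf⟩

/-- An infinite set of integers below `-m` has elements below every `-N`. [folklore] -/
theorem exists_lt_of_infinite {S : Set ℤ} (hS : S.Infinite) (hSm : ∀ t ∈ S, t < -(m : ℤ)) (N : ℕ) :
    ∃ t ∈ S, t < -(N : ℤ) := by
  by_contra h
  push Not at h
  exact hS ((Set.finite_Icc (-(N : ℤ)) (-(m : ℤ))).subset fun t ht => ⟨h t ht, (hSm t ht).le⟩)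

/-- **Anchoring from a one-sided touching cluster**: if the `+`cluster of the upper half-plane
through `x₀`, for a graph `G` between the lattice and the `∗`-graph, has axis sites unboundedly far
to the left but only boundedly far to the right, then `LeftAnchoredInf m ω`. [cite: GeorgiiHiguchi2000, Lemma 5.2 (proof: "the infinite component of `I^{+∗}_up ∖ Δ` almost surely contains infinitely many points of `ℓ_right`")] -/
theorem leftAnchoredInf_of_cluster {G : SimpleGraph (Site 2)} (hG : G ≤ zdStarGraph) {x₀ : Site 2}
    (hlo : ∀ N : ℕ, ∃ t : ℤ, t < -(N : ℤ) ∧ mkSite t 0 ∈ siteCluster G (spinSites 1 ω ∩ halfPlane 0) x₀)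
    (hhi : ∃ T : ℤ, ∀ t : ℤ, mkSite t 0 ∈ siteCluster G (spinSites 1 ω ∩ halfPlane 0) x₀ → t ≤ T) :
    LeftAnchoredInf m ω := by
  classical
  set C := siteCluster G (spinSites 1 ω ∩ halfPlane 0) x₀ with hC
  obtain ⟨T, hT⟩ := hhi
  -- the removed part, inside a finite set `Fs`
  set Fs : Finset (Site 2) := box 2 m ∪ (Finset.Icc (-(m : ℤ)) T).image fun t => mkSite t 0 with hFs
  have hU : ∀ z ∈ C, z ∉ Fs → z ∈ pinU m ω := by
    intro z hz hzF
    refine mem_pinU_of_mem_cluster hz (fun h => hzF (Finset.mem_union_left _ h)) fun ⟨hz1, hz0⟩ => hzF ?_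
    have hzeq : z = mkSite (z 0) 0 := by
      ext i; fin_cases i
      · rfl
      · simpa [mkSite] using hz1
    refine Finset.mem_union_right _ (Finset.mem_image.2 ⟨z 0, Finset.mem_Icc.2 ⟨hz0, hT _ ?_⟩, hzeq.symm⟩)
    rw [← hzeq]; exact hz
  -- a fixed touch left of `-m` and the anchor set
  obtain ⟨t₀, ht₀m, ht₀⟩ := hlo m
  set z₀ : Site 2 := mkSite t₀ 0 with hz₀
  have hz₀F : z₀ ∉ Fs := by
    rw [hFs, Finset.mem_union, not_or]
    refine ⟨fun h => ?_, fun h => ?_⟩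
    · have := (mem_box.1 h 0).1; rw [hz₀, mkSite_apply_zero] at this; omega
    · obtain ⟨t, ht, hteq⟩ := Finset.mem_image.1 h
      have h0 := congrArg (fun z : Site 2 => z 0) hteq
      simp only [mkSite_apply_zero, hz₀] at h0
      rw [Finset.mem_Icc] at ht; omega
  set A : Set (Site 2) := {y | ∃ f ∈ Fs, zdStarGraph.Adj y f} ∪ {z₀} with hA
  have hAfin : A.Finite := by
    refine Set.Finite.union ?_ (Set.finite_singleton _)
    have : {y : Site 2 | ∃ f ∈ Fs, zdStarGraph.Adj y f} ⊆ ⋃ f ∈ (↑Fs : Set (Site 2)), (zdStarGraph.neighborSet f) := by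
      intro y ⟨f, hf, hyf⟩
      exact Set.mem_biUnion (Finset.mem_coe.2 hf) ((mem_neighborSet _ _ _).2 hyf.symm)
    exact (Fs.finite_toSet.biUnion fun f _ => (zdStarGraph.neighborSet f).toFinite).subset this
  -- every `U`-site of `C` has an anchor in its `U`-cluster
  have hanchor : ∀ z ∈ C, z ∉ Fs → ∃ y ∈ A, y ∈ siteCluster zdStarGraph (pinU m ω) z := by
    intro z hz hzF
    obtain ⟨w₀, hw₀⟩ := exists_walk_in_siteCluster hz ht₀
    set w : zdStarGraph.Walk z z₀ := w₀.mapLe hG with hwdef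
    have hw : ∀ v ∈ w.support, v ∈ C := fun v hv => hw₀ v (by rwa [hwdef, Walk.support_mapLe_eq_support] at hv)
    by_cases hex : ∃ y ∈ w.support, y ∈ (↑Fs : Set (Site 2))
    · obtain ⟨a, g, W₀, hag, hg, -, h1, h2⟩ := exists_split_first_mem w (fun h => hzF (Finset.mem_coe.1 h)) hex
      have haC := hw a (h2 a W₀.end_mem_support)
      refine ⟨a, Or.inl ⟨g, Finset.mem_coe.1 hg, hag⟩, hU z hz hzF, hU a haC fun h => h1 a W₀.end_mem_support (Finset.mem_coe.2 h),
        reachable_siteOpenGraph_of_walk W₀ fun v hv => hU v (hw v (h2 v hv)) fun h => h1 v hv (Finset.mem_coe.2 h)⟩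
    · push Not at hex
      refine ⟨z₀, Or.inr rfl, hU z hz hzF, hU z₀ ht₀ hz₀F,
        reachable_siteOpenGraph_of_walk w fun v hv => hU v (hw v hv) fun h => hex v hv (Finset.mem_coe.2 h)⟩
  -- the touches left of `-m` form an infinite set
  set Tset : Set ℤ := {t | t < -(m : ℤ) ∧ mkSite t 0 ∈ C} with hTset
  have hTinf : Tset.Infinite := by
    intro hfin
    obtain ⟨b, hb⟩ := hfin.bddBelow
    obtain ⟨t, ht, htC⟩ := hlo (b.natAbs + m)
    have hb0 := neg_abs_le b
    have hb1 := abs_nonneg b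
    push_cast at ht
    have := hb ⟨by omega, htC⟩
    omega
  -- ... covered by the finitely many anchors' clusters
  have hcover : Tset ⊆ ⋃ y ∈ A, {t | t < -(m : ℤ) ∧ mkSite t 0 ∈ siteCluster zdStarGraph (pinU m ω) y} := by
    rintro t ⟨htm, htC⟩
    have htF : mkSite t 0 ∉ Fs := by
      rw [hFs, Finset.mem_union, not_or]
      refine ⟨fun h => ?_, fun h => ?_⟩
      · have := (mem_box.1 h 0).1; rw [mkSite_apply_zero] at this; omega
      · obtain ⟨t', ht', hteq⟩ := Finset.mem_image.1 h
        have h0 := congrArg (fun z : Site 2 => z 0) hteq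
        simp only [mkSite_apply_zero] at h0
        rw [Finset.mem_Icc] at ht'; omega
    obtain ⟨y, hyA, hy⟩ := hanchor _ htC htF
    refine Set.mem_biUnion hyA ⟨htm, ?_⟩
    have hself : mkSite t 0 ∈ siteCluster zdStarGraph (pinU m ω) (mkSite t 0) := (mem_siteCluster_self_iff _ _ _).2 hy.1
    rw [← siteCluster_eq_of_mem hy ((mem_siteCluster_self_iff _ _ _).2 hy.2.1)]
    exact hself
  -- hence one anchor's cluster contains infinitely many of them
  obtain ⟨y, hyA, hyinf⟩ : ∃ y ∈ A, {t | t < -(m : ℤ) ∧ mkSite t 0 ∈ siteCluster zdStarGraph (pinU m ω) y}.Infinite := by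
    by_contra h
    push Not at h
    exact hTinf ((hAfin.biUnion fun y hy => h y hy).subset hcover)
  -- conclude with any of these touches as `v`
  obtain ⟨t₁, ht₁m, ht₁⟩ := hyinf.nonempty
  have hyself : y ∈ siteCluster zdStarGraph (pinU m ω) y := (mem_siteCluster_self_iff _ _ _).2 ht₁.1
  have hv : siteCluster zdStarGraph (pinU m ω) (mkSite t₁ 0) = siteCluster zdStarGraph (pinU m ω) y :=
    (siteCluster_eq_of_mem ht₁ ((mem_siteCluster_self_iff _ _ _).2 ht₁.2.1)).symm
  refine ⟨mkSite t₁ 0, ?_, mkSite_apply_one _ _, fun N => ?_⟩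
  · show (siteCluster zdStarGraph (pinU m ω) (mkSite t₁ 0)).Infinite
    rw [hv]
    have hinj : Set.InjOn (fun t : ℤ => mkSite t 0) {t | t < -(m : ℤ) ∧ mkSite t 0 ∈ siteCluster zdStarGraph (pinU m ω) y} :=
      fun t _ t' _ h => by have := congrArg (fun z : Site 2 => z 0) h; simpa using this
    exact (hyinf.image hinj).mono (by rintro _ ⟨t, ht, rfl⟩; exact ht.2)
  · obtain ⟨t, ⟨-, ht⟩, htN⟩ := exists_lt_of_infinite hyinf (fun t ht => ht.1) N
    exact ⟨mkSite t 0, by rw [hv]; exact ht, mkSite_apply_one _ _, by rw [mkSite_apply_zero]; exact htN⟩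

end Det

/-! ### Almost sure anchoring in the orientation "`+`face on the left" -/

section AlmostSure

variable {β : ℝ} {μ : Measure (SpinConfig (Site 2))}

/-- **Almost sure anchoring** (`β > β_c(2)`, `μ ∈ 𝒢(β, 0)`): if almost surely the infinite
`+∗`cluster of `π_up` touches the axis outside every box on the left and an infinite `-`cluster
of `π_up` exists, then almost surely `LeftAnchoredInf m` (the touches are bounded on the right by
the sides lemma). [cite: GeorgiiHiguchi2000, Lemma 5.2 (hypothesis) and §5 (set-up of Lemma 5.3)] -/
theorem ae_leftAnchoredInf (hβc : criticalBeta 2 < β) (hμ : μ ∈ isingGibbsMeasures 2 β 0) (m : ℕ)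
    (hL : ∀ᵐ ω ∂μ, ∃ x, ∀ n : ℕ, ∃ k : ℤ, k < -(n : ℤ) ∧
      (![k, 0] : Site 2) ∈ siteCluster zdStarGraph (spinSites 1 ω ∩ halfPlane 0) x)
    (hC : ∀ᵐ ω ∂μ, ∃ y, (siteCluster (zdGraph 2) (spinSites (-1) ω ∩ halfPlane 0) y).Infinite) :
    ∀ᵐ ω ∂μ, LeftAnchoredInf m ω := by
  filter_upwards [hL, hC, ae_plusStar_minus_sides hβc hμ,
    ae_minus_touches_axis_io (G := zdGraph 2) hβc le_rfl zdGraph_le_zdStarGraph hμ] with ω hLω hCω hsides htouch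
  obtain ⟨x₀, hx₀⟩ := hLω
  obtain ⟨y₀, hy₀⟩ := hCω
  have hlo : ∀ N : ℕ, ∃ t : ℤ, t < -(N : ℤ) ∧ mkSite t 0 ∈ siteCluster zdStarGraph (spinSites 1 ω ∩ halfPlane 0) x₀ :=
    fun N => by obtain ⟨k, hk, hkC⟩ := hx₀ N; exact ⟨k, hk, by rw [← vec_eq_mkSite]; exact hkC⟩
  have hinf : (siteCluster zdStarGraph (spinSites 1 ω ∩ halfPlane 0) x₀).Infinite := by
    intro hfin
    obtain ⟨L, hL⟩ := exists_box_of_list hfin.toFinset.toList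
    obtain ⟨t, ht, htC⟩ := hlo L
    have := (mem_box.1 (hL _ (Finset.mem_toList.2 (hfin.mem_toFinset.2 htC))) 0).1
    rw [mkSite_apply_zero] at this; omega
  obtain ⟨k₀, hk₀, -⟩ := exists_axis_far (htouch y₀ hy₀) 0
  refine leftAnchoredInf_of_cluster le_rfl hlo ⟨k₀, fun t ht => ?_⟩
  rcases hsides x₀ y₀ hinf hy₀ with h | h
  · exact (h t k₀ (by rw [vec_eq_mkSite]; exact ht) hk₀).le
  · exfalso
    obtain ⟨t', ht', ht'C⟩ := hlo k₀.natAbs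
    have := h t' k₀ (by rw [vec_eq_mkSite]; exact ht'C) hk₀
    omega

end AlmostSure

end

end Literature.Probability.LatticeModels
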